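import Literature.NumberTheory.LFunctions.SaiasWeingartnerApprox
import Literature.NumberTheory.LFunctions.SaiasWeingartnerPhases
import Literature.NumberTheory.LFunctions.SaiasWeingartnerTools
import Mathlib.NumberTheory.LSeries.Injectivity
import Mathlib.Analysis.Complex.CauchyIntegral
import Mathlib.Analysis.Complex.Convex
import HarnessLib

/-!
# Proof of Saias–Weingartner 2009, Theorem 2, to the right of `σ = 1`

Topic `Literature/NumberTheory/LFunctions` (namespace `Literature.NumberTheory.LFunctions`).
Everything in this file is PROVED; there are no definitions and no named facts. The main result is
the discharge

* `Literature.NumberTheory.LFunctions.SaiasWeingartner2009_thm2_right_holds :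
    SaiasWeingartner2009_thm2_right`

of the named fact of `SaiasWeingartner.lean`: for `F(s) = ∑_j P_j(s) L(s, χ_j)` with at least two
pairwise distinct primitive characters `χ_j` and non-zero Dirichlet polynomials `P_j` there is
`η = η(F) > 0` such that for all `1 ≤ σ₁ < σ₂ ≤ 1 + η` the rectangle `σ₁ < Re s < σ₂`,
`|Im s| ≤ T` contains `≫ T` distinct zeros of `F` for all large `T` (E. Saias, A. Weingartner,
*Zeros of Dirichlet series with periodic coefficients*, Acta Arith. 140 (2009), Thm. 2, §4).

## The proof (§4 of the paper, with two substitutions)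

With `σ = (σ₁ + σ₂)/2` and a height `τ₀` on which no `P_j` vanishes for `1 ≤ Re s ≤ 2`
(`SWTools.exists_forall_ne_zero_horizontal`), prime phases `θ_p` (`p > y`) are chosen so that
the twisted functions `G_j(s) = P_j(s + iτ₀-twist) · L(χ_j u, s)` satisfy `G_j(σ) = T_j` with
`∑_j T_j = 0` (`SWPhases.exists_phases`: the paper's Lemma 2, here by greedy steering instead of
the Brouwer fixed point theorem, from the prime number theorem for arithmetic progressions).
The combination `G = ∑_j G_j` is a twist of `F`, hence the `L`-series of the twisted coefficients
of `F`, which do not all vanish (`SWTwist.exists_coeff_ne_zero`); so `G ≢ 0` near `σ`, and on a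
small circle `|s - σ| = r` one has `|G| ≥ γ > 0`. By the uniform approximation theorem
(`SWApprox.exists_approx`) and Kronecker's theorem with relatively dense times
(`SWTools.exists_relDense_prime_phases`, replacing Weyl's criterion), every real interval of
length `2L` contains `t` with `|F(s + it) - G(s)| < γ/3` on `|s - σ| ≤ r`; the maximum modulus
principle (`SWTools.exists_zero_of_norm_lt`, replacing Rouché's theorem) then gives a zero of
`F` in the disc `|s - (σ + it)| < r`, and zeros from windows `2(L + r) + 1` apart are distinct.

## References

* [SaiasWeingartner2009] E. Saias, A. Weingartner, Acta Arith. 140 (2009), 335–344, Theorem 2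
  and §3–§4 (read: arXiv:0807.0783, pp. 1–8).
* [KaczorowskiKulas2006] J. Kaczorowski, M. Kulas, Monatsh. Math. 150 (2007), Thm. 2 (the left
  half, not used here).
-/

noncomputable section

open Complex Filter Finset LSeries DirichletCharacter Metric Set
open scoped Topology

namespace Literature.NumberTheory.LFunctions

namespace SWProof

/-! ### Dirichlet polynomials -/

/-- A Dirichlet polynomial (finitely supported coefficients) has an entire `L`-series. [folklore] -/
theorem differentiable_LSeries_of_support {f : ℕ → ℂ} {K : ℕ} (hK : ∀ n, f n ≠ 0 → n ≤ K) :
    Differentiable ℂ (LSeries f) := by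
  have heq : LSeries f = fun s ↦ ∑ n ∈ Finset.range (K + 1), term f s n := by
    funext s
    have h := SWApprox.LSeries_eq_sum_of_support hK (fun _ ↦ (1 : ℂ)) s
    simp only [mul_one] at h
    exact h
  rw [heq]
  refine Differentiable.fun_sum fun n _ ↦ ?_
  rcases eq_or_ne n 0 with rfl | hn
  · simp only [term_zero]
    exact differentiable_const _
  · have : (fun s ↦ term f s n) = fun s ↦ f n * (n : ℂ) ^ (-s) := by
      funext s
      rw [term_of_ne_zero hn, cpow_neg, div_eq_mul_inv]
    rw [this]
    exact (differentiable_const _).mul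
      (differentiable_id.neg.const_cpow (Or.inl (Nat.cast_ne_zero.2 hn)))

/-- A Dirichlet polynomial with a non-zero coefficient at some `n ≥ 1` is not the zero function.
[folklore] -/
theorem exists_LSeries_ne_zero {f : ℕ → ℂ} {K : ℕ} (hK : ∀ n, f n ≠ 0 → n ≤ K) {n₀ : ℕ}
    (hn₀ : n₀ ≠ 0) (hf : f n₀ ≠ 0) : ∃ z : ℂ, LSeries f z ≠ 0 := by
  classical
  by_contra h
  push Not at h
  set g : ℕ → ℂ := fun n ↦ if n = 0 then 0 else f n with hg
  have hfg : ∀ {n : ℕ}, n ≠ 0 → f n = g n := fun {n} hn ↦ by simp [hg, hn]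
  have hLg : LSeries g = 0 := by
    funext z
    rw [← LSeries_congr hfg z, h z]
    rfl
  have hsumm : ∀ s : ℂ, LSeriesSummable g s := by
    intro s
    have := SWTwist.LSeriesSummable_of_finite (f := g) ?_ (fun _ ↦ (1 : ℂ)) s
    · simpa only [mul_one] using this
    · refine (Finset.range (K + 1)).finite_toSet.subset fun n hn ↦ ?_
      rw [Function.mem_support] at hn
      simp only [coe_range, Set.mem_Iio]
      have hn0 : n ≠ 0 := fun h0 ↦ hn (by simp [hg, h0])
      have : f n ≠ 0 := by simpa [hg, hn0] using hn
      exact Nat.lt_succ_of_le (hK n this)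
  have habs : abscissaOfAbsConv g ≠ ⊤ := by
    have : abscissaOfAbsConv g ≤ (0 : ℝ) :=
      abscissaOfAbsConv_le_of_forall_lt_LSeriesSummable fun y _ ↦ hsumm y
    exact ne_top_of_le_ne_top (EReal.coe_ne_top 0) this
  have h0 : g 0 = 0 := by simp [hg]
  rcases (LSeries_eq_zero_iff h0).1 hLg with hz | htop
  · have : g n₀ = 0 := by rw [hz]; rfl
    rw [← hfg hn₀] at this
    exact hf this
  · exact habs htop

/-! ### The combination as a function of `s + it` -/

/-- `F` is complex differentiable away from `s = 1`. [folklore] -/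
theorem differentiableAt_charCombination {ι : Type*} [Fintype ι] {q : ι → ℕ} [∀ i, NeZero (q i)]
    (χ : ∀ i, DirichletCharacter ℂ (q i)) {P : ι → ℕ → ℂ} {K : ℕ}
    (hK : ∀ i n, P i n ≠ 0 → n ≤ K) {s : ℂ} (hs : s ≠ 1) :
    DifferentiableAt ℂ (charCombination χ P) s := by
  have : charCombination χ P = fun s ↦ ∑ i, LSeries (P i) s * (χ i).LFunction s := rfl
  rw [this]
  refine DifferentiableAt.fun_sum fun i _ ↦ ?_
  exact ((differentiable_LSeries_of_support (hK i)) s).mul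
    (differentiableAt_LFunction (χ i) s (Or.inl hs))

/-- **`F(s + it)` is the twisted combination** for the shift twist `u(n) = n^{-it}`:
`F(s + it) = ∑_j L(P_j u, s) L(χ_j u, s)` for `Re s > 1`. [folklore] -/
theorem charCombination_add_eq {ι : Type*} [Fintype ι] {q : ι → ℕ} [∀ i, NeZero (q i)]
    (χ : ∀ i, DirichletCharacter ℂ (q i)) (P : ι → ℕ → ℂ) {s : ℂ} (hs : 1 < s.re) (t : ℝ)
    {u : ℕ →*₀ ℂ} (hu : ∀ n : ℕ, n ≠ 0 → u n = (n : ℂ) ^ (-(t * I))) :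
    charCombination χ P (s + t * I) =
      ∑ i, LSeries (fun n ↦ P i n * u n) s * LSeries (fun n ↦ χ i n * u n) s := by
  rw [charCombination_apply]
  refine Finset.sum_congr rfl fun i _ ↦ ?_
  have hre : 1 < (s + t * I).re := by simpa using hs
  rw [LFunction_eq_LSeries (χ i) hre, SWTwist.LSeries_add_eq_twist (P i) s t hu,
    SWTwist.LSeries_add_eq_twist (fun n ↦ χ i n) s t hu]

/-! ### Splitting the twisted Euler product at `y` -/

/-- If the logarithms of the Euler factors at the primes `p > y` sum to `z`, then
`L(χ v, σ) = exp (∑_{p ≤ y} -log(1 - χ(p) v(p) p^{-σ})) · exp z`. [folklore] -/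
theorem LSeries_twist_eq_exp_mul {N : ℕ} (χ : DirichletCharacter ℂ N) {v : ℕ →*₀ ℂ}
    (hv : ∀ p, p.Prime → ‖v p‖ = 1) {s : ℂ} (hs : 1 < s.re) (y : ℕ) {z : ℂ}
    (hz : HasSum (fun k : ℕ ↦ if k.Prime ∧ y < k then -log (1 - χ k * v k * (k : ℂ) ^ (-s))
      else 0) z) :
    LSeries (fun n ↦ χ n * v n) s =
      cexp (∑ k ∈ Finset.range (y + 1), if k.Prime then -log (1 - χ k * v k * (k : ℂ) ^ (-s))
        else 0) * cexp z := by
  classical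
  rw [SWApprox.LSeries_twist_eq_exp χ hv hs, ← Complex.exp_add]
  congr 1
  set g : ℕ → ℂ := fun k ↦ if k.Prime then -log (1 - χ k * v k * (k : ℂ) ^ (-s)) else 0 with hg
  set gs : ℕ → ℂ := fun k ↦ if k ≤ y then g k else 0 with hgs
  set gt : ℕ → ℂ := fun k ↦ if k.Prime ∧ y < k then -log (1 - χ k * v k * (k : ℂ) ^ (-s))
    else 0 with hgt
  have hsplit : g = fun k ↦ gs k + gt k := by
    funext k
    simp only [hg, hgs, hgt]
    by_cases hk : k ≤ y
    · have : ¬(k.Prime ∧ y < k) := fun h ↦ absurd h.2 (not_lt.2 hk)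
      simp [hk, this]
    · push Not at hk
      by_cases hp : k.Prime
      · simp [hk, hp, not_le.2 hk]
      · simp [hp, not_le.2 hk]
  have hgs_supp : ∀ k ∉ Finset.range (y + 1), gs k = 0 := by
    intro k hk
    rw [Finset.mem_range, not_lt] at hk
    simp [hgs, show ¬k ≤ y by omega]
  have hgs_sum : HasSum gs (∑ k ∈ Finset.range (y + 1), gs k) := hasSum_sum_of_ne_finset_zero hgs_supp
  have htot := hgs_sum.add hz
  rw [← hsplit] at htot
  rw [htot.tsum_eq]
  congr 1
  refine Finset.sum_congr rfl fun k hk ↦ ?_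
  rw [Finset.mem_range] at hk
  simp [hgs, show k ≤ y by omega]

/-! ### Counting distinct zeros from relatively dense windows -/

/-- **From one zero in every window to `≫ T` distinct zeros.** If for every real `s₀` the function
`F` has a zero `ρ` with `|Re ρ - σ| < r` and `|Im ρ - s₀| ≤ D`, then for all large `T` there are
at least `T / (2(2D+1))` distinct zeros `ρ` of `F` with `|Re ρ - σ| < r` and `|Im ρ| ≤ T`.
[cite: SaiasWeingartner2009, §4 (last paragraph)] -/
theorem exists_many_zeros {F : ℂ → ℂ} {σ r D : ℝ} (hD : 0 ≤ D)
    (h : ∀ s₀ : ℝ, ∃ ρ : ℂ, F ρ = 0 ∧ |ρ.re - σ| < r ∧ |ρ.im - s₀| ≤ D) :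
    ∃ c : ℝ, 0 < c ∧ ∃ T₀ : ℝ, ∀ T : ℝ, T₀ ≤ T →
      ∃ Z : Finset ℂ, c * T ≤ Z.card ∧ ∀ z ∈ Z, |z.re - σ| < r ∧ |z.im| ≤ T ∧ F z = 0 := by
  classical
  choose ρ hρ using h
  set Δ : ℝ := 2 * D + 1 with hΔ
  have hΔpos : 0 < Δ := by rw [hΔ]; linarith
  refine ⟨1 / (2 * Δ), by positivity, 4 * Δ, fun T hT ↦ ?_⟩
  have hT0 : 0 ≤ T := le_trans (by positivity) hT
  -- number of windows
  set N : ℕ := ⌊T / Δ⌋₊ - 1 with hN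
  have hfloor_le : (⌊T / Δ⌋₊ : ℝ) ≤ T / Δ := Nat.floor_le (by positivity)
  have hfloor_gt : T / Δ < (⌊T / Δ⌋₊ : ℝ) + 1 := Nat.lt_floor_add_one _
  have h4 : (4 : ℝ) ≤ T / Δ := by rw [le_div_iff₀ hΔpos]; linarith
  have hfloor1 : 1 ≤ ⌊T / Δ⌋₊ := by
    have : (1 : ℝ) ≤ (⌊T / Δ⌋₊ : ℝ) := by linarith
    exact_mod_cast this
  have hNreal : (N : ℝ) = (⌊T / Δ⌋₊ : ℝ) - 1 := by
    rw [hN, Nat.cast_sub hfloor1, Nat.cast_one]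
  -- the zeros
  set f : ℕ → ℂ := fun k ↦ ρ (((k : ℝ) + 1) * Δ) with hf
  have hinj : Set.InjOn f (Finset.range N : Set ℕ) := by
    intro j _ k _ hjk
    have h1 := (hρ (((j : ℝ) + 1) * Δ)).2.2
    have h2 := (hρ (((k : ℝ) + 1) * Δ)).2.2
    simp only [hf] at hjk
    rw [hjk] at h1
    -- `|(j - k) Δ| ≤ 2D < Δ`
    have h3 : |((j : ℝ) - k) * Δ| ≤ 2 * D := by
      have := abs_sub_le (((j : ℝ) + 1) * Δ) ((ρ (((k : ℝ) + 1) * Δ)).im) (((k : ℝ) + 1) * Δ)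
      rw [abs_sub_comm] at h1
      calc |((j : ℝ) - k) * Δ| = |((j : ℝ) + 1) * Δ - ((k : ℝ) + 1) * Δ| := by
            congr 1; ring
        _ ≤ D + D := by linarith
        _ = 2 * D := by ring
    have h4 : |(j : ℝ) - k| < 1 := by
      rw [abs_mul, abs_of_pos hΔpos] at h3
      by_contra h5
      push Not at h5
      have : Δ ≤ |(j : ℝ) - k| * Δ := le_mul_of_one_le_left hΔpos.le h5
      linarith
    have h5 : |((j : ℤ) - k : ℤ)| < 1 := by exact_mod_cast h4
    have : (j : ℤ) = k := by
      have := abs_lt.1 h5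
      omega
    exact_mod_cast this
  refine ⟨(Finset.range N).image f, ?_, ?_⟩
  · rw [Finset.card_image_of_injOn hinj, Finset.card_range, hNreal]
    have : 1 / (2 * Δ) * T = (T / Δ) / 2 := by field_simp
    rw [this]
    linarith
  · intro z hz
    rw [Finset.mem_image] at hz
    obtain ⟨k, hk, rfl⟩ := hz
    rw [Finset.mem_range] at hk
    obtain ⟨hz0, hre, him⟩ := hρ (((k : ℝ) + 1) * Δ)
    refine ⟨hre, ?_, hz0⟩
    have hk' : (k : ℝ) + 1 ≤ N := by exact_mod_cast Nat.succ_le_of_lt hk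
    have h1 : |(f k).im| ≤ ((k : ℝ) + 1) * Δ + D := by
      have := abs_sub_abs_le_abs_sub ((f k).im) (((k : ℝ) + 1) * Δ)
      rw [abs_of_pos (by positivity : (0 : ℝ) < ((k : ℝ) + 1) * Δ)] at this
      simp only [hf] at him ⊢
      linarith
    calc |(f k).im| ≤ ((k : ℝ) + 1) * Δ + D := h1
      _ ≤ (N : ℝ) * Δ + D := by gcongr
      _ = ((⌊T / Δ⌋₊ : ℝ) - 1) * Δ + D := by rw [hNreal]
      _ ≤ (T / Δ - 1) * Δ + D := by gcongr
      _ = T - Δ + D := by rw [sub_mul, div_mul_cancel₀ T hΔpos.ne', one_mul]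
      _ ≤ T := by rw [hΔ]; linarith


/-! ### The twisted combination does not vanish identically -/

/-- **The twisted combination is analytic on `Re s > 1` and not locally zero there.** For a
twist `u`, `G(s) = ∑_j L(P_j u, s) L(χ_j u, s)` is the `L`-series of `a · u`, `a = ∑_j P_j ⋆ χ_j`
the coefficients of `F` (`SWTwist.sum_LSeries_mul_eq`), which do not all vanish
(`SWTwist.exists_coeff_ne_zero`); by the identity principle and the injectivity of the
`L`-series transform, `G` is not identically zero near any point of the half-plane.
[cite: SaiasWeingartner2009, §4] -/
theorem analyticOnNhd_and_eventually_ne_zero {ι : Type} [Fintype ι] {q : ι → ℕ}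
    [∀ i, NeZero (q i)] {χ : ∀ i, DirichletCharacter ℂ (q i)} {P : ι → ℕ → ℂ}
    (hF : IsSWFamily χ P) {u : ℕ →*₀ ℂ} (hu : ∀ p, p.Prime → ‖u p‖ = 1) :
    AnalyticOnNhd ℂ (fun s ↦ ∑ i, LSeries (fun n ↦ P i n * u n) s *
        LSeries (fun n ↦ χ i n * u n) s) {s : ℂ | 1 < s.re} ∧
    ∀ s₀ : ℂ, 1 < s₀.re → ∀ᶠ s in 𝓝[≠] s₀,
      ∑ i, LSeries (fun n ↦ P i n * u n) s * LSeries (fun n ↦ χ i n * u n) s ≠ 0 := by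
  classical
  set a : ℕ → ℂ := fun n ↦ ∑ i, (LSeries.convolution (P i) (fun m ↦ χ i m)) n with ha
  set G : ℂ → ℂ := fun s ↦ ∑ i, LSeries (fun n ↦ P i n * u n) s *
    LSeries (fun n ↦ χ i n * u n) s with hG
  set U : Set ℂ := {s : ℂ | 1 < s.re} with hU
  have hUo : IsOpen U := isOpen_lt continuous_const continuous_re
  have hGU : ∀ s ∈ U, G s = LSeries (fun n ↦ a n * u n) s := fun s hs ↦
    SWTwist.sum_LSeries_mul_eq χ hF.finite_support hu hs
  -- summability of `a u` for `Re s > 1`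
  have hsumm : ∀ s : ℂ, 1 < s.re → LSeriesSummable (fun n ↦ a n * u n) s := by
    intro s hs
    have heq : (fun n ↦ a n * u n) =
        ∑ i ∈ (univ : Finset ι),
          LSeries.convolution (fun n ↦ P i n * u n) (fun n ↦ χ i n * u n) := by
      funext n
      rw [Finset.sum_apply]
      simp only [ha, SWTwist.convolution_twist, Finset.sum_mul]
    rw [heq]
    exact LSeriesSummable.sum fun i _ ↦ (SWTwist.LSeriesSummable_of_finite (hF.finite_support i)
      u s).convolution (SWTwist.LSeriesSummable_twist (χ i) hu hs)
  have habs : abscissaOfAbsConv (fun n ↦ a n * u n) ≤ (1 : ℝ) :=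
    abscissaOfAbsConv_le_of_forall_lt_LSeriesSummable fun y hy ↦
      hsumm y (by simpa using hy)
  have hLan : AnalyticOnNhd ℂ (LSeries (fun n ↦ a n * u n)) U :=
    (LSeries_analyticOnNhd _).mono fun s hs ↦ lt_of_le_of_lt habs (by exact_mod_cast hs)
  have hGan : AnalyticOnNhd ℂ G U := by
    intro s hs
    refine (hLan s hs).congr ?_
    filter_upwards [hUo.mem_nhds hs] with z hz
    exact (hGU z hz).symm
  refine ⟨hGan, fun s₀ hs₀ ↦ ?_⟩
  rcases (hGan s₀ hs₀).eventually_eq_zero_or_eventually_ne_zero with h0 | hne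
  · exfalso
    have hEq : EqOn G 0 U := hGan.eqOn_zero_of_preconnected_of_eventuallyEq_zero
      (convex_halfSpace_re_gt 1).isPreconnected hs₀ h0
    have hev : (fun x : ℝ ↦ LSeries (fun n ↦ a n * u n) x) =ᶠ[atTop] 0 := by
      filter_upwards [eventually_gt_atTop 1] with x hx
      have hxU : (x : ℂ) ∈ U := by simpa [hU] using hx
      rw [← hGU x hxU]
      exact hEq hxU
    rcases LSeries_eventually_eq_zero_iff'.1 hev with hzero | htop
    · obtain ⟨N, hN⟩ := SWTwist.exists_coeff_ne_zero hF
      have hN0 : N ≠ 0 := by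
        rintro rfl
        apply hN
        simp [LSeries.convolution_map_zero]
      have h1 := hzero N hN0
      have hu0 : u N ≠ 0 := norm_ne_zero_iff.1 (by rw [SWTwist.norm_twist hu hN0]; exact one_ne_zero)
      exact hN ((mul_eq_zero.1 h1).resolve_right hu0)
    · exact absurd htop (ne_top_of_le_ne_top (EReal.coe_ne_top 1) habs)
  · exact hne

/-- **A circle on which `G` is bounded below.** If `G` is continuous on the open disc
`|z - c| < R` and not identically zero near `c`, there are `0 < r < R`, `r ≤ R/2`, and `γ > 0`
with `γ ≤ |G|` on the circle `|z - c| = r`. [folklore] -/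
theorem exists_sphere_bound {G : ℂ → ℂ} {c : ℂ} {R : ℝ} (hR : 0 < R)
    (hcont : ∀ z, dist z c < R → ContinuousAt G z) (hne : ∀ᶠ z in 𝓝[≠] c, G z ≠ 0) :
    ∃ r : ℝ, 0 < r ∧ r < R ∧ ∃ γ : ℝ, 0 < γ ∧ ∀ z ∈ sphere c r, γ ≤ ‖G z‖ := by
  rw [eventually_nhdsWithin_iff, Metric.eventually_nhds_iff] at hne
  obtain ⟨ε, hε, hεne⟩ := hne
  set r : ℝ := min (ε / 2) (R / 2) with hr
  have hr0 : 0 < r := lt_min (half_pos hε) (half_pos hR)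
  have hrε : r < ε := lt_of_le_of_lt (min_le_left _ _) (half_lt_self hε)
  have hrR : r < R := lt_of_le_of_lt (min_le_right _ _) (half_lt_self hR)
  have hK : IsCompact (sphere c r) := isCompact_sphere _ _
  have hKne : (sphere c r).Nonempty := NormedSpace.sphere_nonempty.2 hr0.le
  have hcs : ContinuousOn (fun z ↦ ‖G z‖) (sphere c r) := by
    refine fun z hz ↦ (continuous_norm.continuousAt.comp (hcont z ?_)).continuousWithinAt
    rw [mem_sphere.1 hz]; exact hrR
  obtain ⟨z₀, hz₀, hmin⟩ := hK.exists_isMinOn hKne hcs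
  have hz₀ne : G z₀ ≠ 0 := by
    refine hεne ?_ ?_
    · rw [mem_sphere.1 hz₀]; exact hrε
    · intro h
      rw [mem_sphere, h, dist_self] at hz₀
      exact hr0.ne' hz₀.symm
  exact ⟨r, hr0, hrR, ‖G z₀‖, norm_pos_iff.2 hz₀ne, fun z hz ↦ hmin hz⟩

/-! ### The theorem -/

/-- **Saias–Weingartner 2009, Theorem 2, to the right of `σ = 1`** (discharge of the named
fact `SaiasWeingartner2009_thm2_right`): for `F = ∑ⱼ Pⱼ L(·, χⱼ)` with `≥ 2` pairwise distinct
primitive characters and non-zero Dirichlet polynomials there is `η = η(F) > 0` such that for all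
`1 ≤ σ₁ < σ₂ ≤ 1 + η`, `N'_F(σ₁, σ₂, T) ≫ T` for all large `T`. See the module docstring for
the proof (§4 of the paper with greedy steering for Lemma 2, Kronecker's theorem for Weyl's
criterion and the maximum modulus principle for Rouché's theorem).
[cite: SaiasWeingartner2009, Thm. 2 and §4] -/
theorem thm2_right : SaiasWeingartner2009_thm2_right := by
  intro ι _ q _ χ P hF
  classical
  -- common modulus and induced characters
  set Q : ℕ := ∏ i, q i with hQdef
  have hQ0 : Q ≠ 0 := Finset.prod_ne_zero_iff.2 fun i _ ↦ NeZero.ne (q i)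
  haveI : NeZero Q := ⟨hQ0⟩
  have hdvd : ∀ i, q i ∣ Q := fun i ↦ Finset.dvd_prod_of_mem q (Finset.mem_univ i)
  set ψ : ι → DirichletCharacter ℂ Q := fun i ↦ changeLevel (hdvd i) (χ i) with hψdef
  have hψ : Function.Injective ψ := fun i j hij ↦ hF.injective
    (SWTwist.sigma_eq_of_changeLevel_eq (χ i) (χ j) (hdvd i) (hdvd j) (hF.isPrimitive i)
      (hF.isPrimitive j) hij)
  have hχψ : ∀ (i : ι) (p : ℕ), p.Prime → Q < p → χ i p = ψ i p := by
    intro i p hp hQp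
    have hcop : IsCoprime (p : ℤ) Q := by
      rw [Nat.isCoprime_iff_coprime]
      exact (Nat.Prime.coprime_iff_not_dvd hp).2
        fun h ↦ absurd (Nat.le_of_dvd (Nat.pos_of_ne_zero hQ0) h) (by omega)
    have h1 := changeLevel_eq_cast_of_dvd' (χ i) (hdvd i) hcop
    rw [Int.cast_natCast, Int.cast_natCast] at h1
    exact h1.symm
  -- support bound and cut-off
  obtain ⟨K, hK⟩ : ∃ K : ℕ, ∀ i n, P i n ≠ 0 → n ≤ K := by
    choose K hK using fun i ↦ (hF.finite_support i).bddAbove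
    exact ⟨Finset.univ.sup K, fun i n hn ↦
      (hK i (Function.mem_support.2 hn)).trans (Finset.le_sup (Finset.mem_univ i))⟩
  set y : ℕ := max K Q with hydef
  have hKy : K ≤ y := le_max_left _ _
  have hQy : Q ≤ y := le_max_right _ _
  -- a zero-free horizontal segment for the Dirichlet polynomials
  obtain ⟨τ₀, hτ₀⟩ := SWTools.exists_forall_ne_zero_horizontal (fun i s ↦ LSeries (P i) s)
    (fun i ↦ Complex.analyticOnNhd_univ_iff_differentiable.2
      (differentiable_LSeries_of_support (hK i)))
    (fun i ↦ (hF.exists_ne_zero i).elim fun n hn ↦ exists_LSeries_ne_zero (hK i) hn.1 hn.2) 1 2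
  obtain ⟨u₀, hu₀p, hu₀1, hu₀n⟩ := SWTwist.exists_shift_twist τ₀
  -- lower bounds `c i` for `|P_i(σ + iτ₀)|`, `1 ≤ σ ≤ 2`
  have hcont : ∀ i, ContinuousOn (fun σ' : ℝ ↦ ‖LSeries (P i) ((σ' : ℂ) + (τ₀ : ℂ) * I)‖)
      (Icc 1 2) := fun i ↦
    (continuous_norm.comp ((differentiable_LSeries_of_support (hK i)).continuous.comp
      (continuous_ofReal.add continuous_const))).continuousOn
  have hc : ∀ i, ∃ c : ℝ, 0 < c ∧ ∀ σ' ∈ Icc (1 : ℝ) 2,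
      c ≤ ‖LSeries (P i) ((σ' : ℂ) + (τ₀ : ℂ) * I)‖ := by
    intro i
    obtain ⟨σm, hσm, hmin⟩ := isCompact_Icc.exists_isMinOn ⟨1, by norm_num⟩ (hcont i)
    exact ⟨_, norm_pos_iff.2 (hτ₀ i σm hσm), fun σ' hσ' ↦ hmin hσ'⟩
  choose c hc using hc
  have huniv : (Finset.univ : Finset ι).Nonempty := Finset.univ_nonempty_iff.2 hF.nonempty
  set c₂ : ℝ := Finset.univ.inf' huniv c with hc₂def
  have hc₂ : 0 < c₂ := (Finset.lt_inf'_iff huniv).2 fun i _ ↦ (hc i).1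
  have hc₂le : ∀ i, c₂ ≤ c i := fun i ↦ Finset.inf'_le _ (Finset.mem_univ i)
  -- upper bound `C₂`
  set C₂ : ℝ := ∑ i, ∑ n ∈ Finset.range (K + 1), ‖P i n‖ + 1 with hC₂def
  have hC₂1 : 1 ≤ C₂ := by
    have : 0 ≤ ∑ i, ∑ n ∈ Finset.range (K + 1), ‖P i n‖ :=
      Finset.sum_nonneg fun i _ ↦ Finset.sum_nonneg fun n _ ↦ norm_nonneg _
    rw [hC₂def]; linarith
  have hC₂ : ∀ (i : ι) (σ' : ℝ), 0 ≤ σ' → ‖LSeries (P i) ((σ' : ℂ) + (τ₀ : ℂ) * I)‖ ≤ C₂ := by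
    intro i σ' hσ'
    rw [SWTwist.LSeries_add_eq_twist (P i) σ' τ₀ hu₀n]
    refine (SWApprox.norm_LSeries_le (hK i) (SWTwist.norm_twist_le hu₀1) (by simpa using hσ')).trans ?_
    have : ∑ n ∈ Finset.range (K + 1), ‖P i n‖ ≤ ∑ i, ∑ n ∈ Finset.range (K + 1), ‖P i n‖ :=
      Finset.single_le_sum (f := fun i ↦ ∑ n ∈ Finset.range (K + 1), ‖P i n‖)
        (fun i _ ↦ Finset.sum_nonneg fun n _ ↦ norm_nonneg _) (Finset.mem_univ i)
    rw [hC₂def]; linarith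
  -- bound `S₀` for the small-prime exponents
  set S₀ : ℝ := 3 / 2 * (y + 1) with hS₀def
  have hS₀0 : 0 ≤ S₀ := by positivity
  have hS₀ : ∀ (i : ι) (v : ℕ →*₀ ℂ), (∀ p, p.Prime → ‖v p‖ = 1) → ∀ σ' : ℝ, 1 ≤ σ' →
      ‖∑ k ∈ Finset.range (y + 1), (if k.Prime then
        -log (1 - χ i k * v k * (k : ℂ) ^ (-(σ' : ℂ))) else 0)‖ ≤ S₀ := by
    intro i v hv σ' hσ'
    refine (norm_sum_le _ _).trans ?_
    have : ∀ k ∈ Finset.range (y + 1), ‖(if k.Prime then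
        -log (1 - χ i k * v k * (k : ℂ) ^ (-(σ' : ℂ))) else 0)‖ ≤ 3 / 2 := by
      intro k _
      refine (SWApprox.norm_logTerm_le (χ i) hv le_rfl (s := (σ' : ℂ)) (by simpa using hσ') k).trans ?_
      split_ifs with hk
      · have : (k : ℝ) ^ (-(1 : ℝ)) ≤ 1 :=
          Real.rpow_le_one_of_one_le_of_nonpos (by exact_mod_cast hk.one_lt.le) (by norm_num)
        linarith
      · norm_num
    refine (Finset.sum_le_sum this).trans ?_
    rw [Finset.sum_const, Finset.card_range, nsmul_eq_mul, hS₀def]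
    push_cast
    linarith
  -- the bound `W` for the logarithms of the targets
  set n : ℝ := (Fintype.card ι : ℝ) with hndef
  have hn2 : (2 : ℝ) ≤ n := by rw [hndef]; exact_mod_cast hF.two_le_card
  set W : ℝ := |Real.log (n * Real.exp S₀ / c₂)| + |Real.log (C₂ * Real.exp S₀)| + Real.pi
    with hWdef
  have hW : 0 ≤ W := by rw [hWdef]; positivity
  -- `η`
  obtain ⟨η, hη, hη2, hphases⟩ := SWPhases.exists_phases ψ hψ hQy hW
  refine ⟨η, hη, fun σ₁ σ₂ h1 h12 h2 ↦ ?_⟩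
  -- the centre `σ` and the half-width `r₀`
  set σ : ℝ := (σ₁ + σ₂) / 2 with hσdef
  set r₀ : ℝ := (σ₂ - σ₁) / 2 with hr₀def
  have hσ1 : 1 < σ := by rw [hσdef]; linarith
  have hση : σ ≤ 1 + η := by rw [hσdef]; linarith
  have hσ2 : σ ≤ 2 := by linarith
  have hr₀ : 0 < r₀ := by rw [hr₀def]; linarith
  have hσr₀ : σ - r₀ = σ₁ := by rw [hσdef, hr₀def]; ring
  have hσr₀' : σ + r₀ = σ₂ := by rw [hσdef, hr₀def]; ring
  -- targets `T i` with `∑ T i = 0`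
  obtain ⟨i₁, i₂, hi₁₂⟩ := hF.exists_pair_ne
  set T : ι → ℂ := fun i ↦ if i = i₂ then -((n : ℂ) - 1) else 1 with hTdef
  have hTsum : ∑ i, T i = 0 := by
    have : ∀ i, T i = 1 + (if i = i₂ then -(n : ℂ) else 0) := by
      intro i; simp only [hTdef]; split_ifs <;> ring
    simp_rw [this]
    rw [Finset.sum_add_distrib, Finset.sum_const, Finset.card_univ, Finset.sum_ite_eq']
    simp [hndef]
  have hTne : ∀ i, T i ≠ 0 := by
    intro i
    simp only [hTdef]
    split_ifs
    · have : (n : ℂ) - 1 ≠ 0 := by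
        have : (1 : ℝ) < n := by linarith
        exact_mod_cast (by linarith : n - 1 ≠ 0)
      exact neg_ne_zero.2 this
    · exact one_ne_zero
  have hTle : ∀ i, ‖T i‖ ≤ n := by
    intro i
    simp only [hTdef]
    split_ifs
    · rw [norm_neg, show (n : ℂ) - 1 = ((n - 1 : ℝ) : ℂ) by push_cast; ring, norm_real,
        Real.norm_of_nonneg (by linarith)]
      linarith
    · rw [norm_one]; linarith
  have hTge : ∀ i, 1 ≤ ‖T i‖ := by
    intro i
    simp only [hTdef]
    split_ifs
    · rw [norm_neg, show (n : ℂ) - 1 = ((n - 1 : ℝ) : ℂ) by push_cast; ring, norm_real,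
        Real.norm_of_nonneg (by linarith)]
      linarith
    · rw [norm_one]
  -- the values to prescribe
  set E : ι → ℂ := fun i ↦ ∑ k ∈ Finset.range (y + 1), (if k.Prime then
    -log (1 - χ i k * u₀ k * (k : ℂ) ^ (-(σ : ℂ))) else 0) with hEdef
  set LP : ι → ℂ := fun i ↦ LSeries (P i) ((σ : ℂ) + (τ₀ : ℂ) * I) with hLPdef
  have hLPne : ∀ i, LP i ≠ 0 := fun i ↦ hτ₀ i σ ⟨hσ1.le, hσ2⟩
  set Z : ι → ℂ := fun i ↦ T i / (LP i * cexp (E i)) with hZdef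
  have hZne : ∀ i, Z i ≠ 0 := fun i ↦
    div_ne_zero (hTne i) (mul_ne_zero (hLPne i) (Complex.exp_ne_zero _))
  set z : ι → ℂ := fun i ↦ log (Z i) with hzdef
  have hz : ∀ i, ‖z i‖ ≤ W := by
    intro i
    have hE : ‖E i‖ ≤ S₀ := hS₀ i u₀ hu₀1 σ hσ1.le
    have hexp_le : ‖cexp (E i)‖ ≤ Real.exp S₀ := by
      rw [norm_exp]; exact Real.exp_le_exp.2 ((re_le_norm _).trans hE)
    have hexp_ge : Real.exp (-S₀) ≤ ‖cexp (E i)‖ := by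
      rw [norm_exp]; refine Real.exp_le_exp.2 ?_
      have := abs_re_le_norm (E i)
      have := neg_abs_le (E i).re
      linarith
    have hLP_le : ‖LP i‖ ≤ C₂ := hC₂ i σ (by linarith)
    have hLP_ge : c₂ ≤ ‖LP i‖ := (hc₂le i).trans ((hc i).2 σ ⟨hσ1.le, hσ2⟩)
    have hZnorm : ‖Z i‖ = ‖T i‖ / (‖LP i‖ * ‖cexp (E i)‖) := by
      rw [hZdef]; simp only; rw [norm_div, norm_mul]
    have hden : 0 < ‖LP i‖ * ‖cexp (E i)‖ := mul_pos (lt_of_lt_of_le hc₂ hLP_ge) (norm_pos_iff.2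
      (Complex.exp_ne_zero _))
    have hZpos : 0 < ‖Z i‖ := norm_pos_iff.2 (hZne i)
    -- upper and lower bounds for `‖Z i‖`
    have hup : ‖Z i‖ ≤ n * Real.exp S₀ / c₂ := by
      rw [hZnorm, div_le_div_iff₀ hden hc₂]
      have h1 : ‖T i‖ * c₂ ≤ n * c₂ := mul_le_mul_of_nonneg_right (hTle i) hc₂.le
      have h2 : n * c₂ ≤ n * Real.exp S₀ * (‖LP i‖ * ‖cexp (E i)‖) := by
        have h3 : c₂ * Real.exp (-S₀) ≤ ‖LP i‖ * ‖cexp (E i)‖ :=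
          mul_le_mul hLP_ge hexp_ge (Real.exp_pos _).le (norm_nonneg _)
        have h4 : Real.exp S₀ * Real.exp (-S₀) = 1 := by
          rw [← Real.exp_add, add_neg_cancel, Real.exp_zero]
        have h5 : n * Real.exp S₀ * (c₂ * Real.exp (-S₀)) ≤
            n * Real.exp S₀ * (‖LP i‖ * ‖cexp (E i)‖) :=
          mul_le_mul_of_nonneg_left h3 (by positivity)
        have h6 : n * Real.exp S₀ * (c₂ * Real.exp (-S₀)) = n * c₂ := by
          calc n * Real.exp S₀ * (c₂ * Real.exp (-S₀))
              = n * c₂ * (Real.exp S₀ * Real.exp (-S₀)) := by ring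
            _ = n * c₂ := by rw [h4, mul_one]
        linarith
      linarith
    have hlow : 1 / (C₂ * Real.exp S₀) ≤ ‖Z i‖ := by
      rw [hZnorm, div_le_div_iff₀ (by positivity) hden, one_mul]
      calc ‖LP i‖ * ‖cexp (E i)‖ ≤ C₂ * Real.exp S₀ :=
            mul_le_mul hLP_le hexp_le (norm_nonneg _) (by linarith)
        _ ≤ ‖T i‖ * (C₂ * Real.exp S₀) := le_mul_of_one_le_left (by positivity) (hTge i)
    have hlog_up : Real.log ‖Z i‖ ≤ Real.log (n * Real.exp S₀ / c₂) := Real.log_le_log hZpos hup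
    have hlog_low : -Real.log (C₂ * Real.exp S₀) ≤ Real.log ‖Z i‖ := by
      rw [← Real.log_inv, ← one_div]
      exact Real.log_le_log (by positivity) hlow
    have habs : |Real.log ‖Z i‖| ≤ |Real.log (n * Real.exp S₀ / c₂)| +
        |Real.log (C₂ * Real.exp S₀)| := by
      rw [abs_le]
      constructor
      · linarith [le_abs_self (Real.log (C₂ * Real.exp S₀)),
          abs_nonneg (Real.log (n * Real.exp S₀ / c₂))]
      · linarith [le_abs_self (Real.log (n * Real.exp S₀ / c₂)),
          abs_nonneg (Real.log (C₂ * Real.exp S₀))]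
    calc ‖z i‖ ≤ |(z i).re| + |(z i).im| := norm_le_abs_re_add_abs_im _
      _ = |Real.log ‖Z i‖| + |arg (Z i)| := by rw [hzdef]; simp only [log_re, log_im]
      _ ≤ (|Real.log (n * Real.exp S₀ / c₂)| + |Real.log (C₂ * Real.exp S₀)|) + Real.pi :=
          add_le_add habs (abs_arg_le_pi _)
      _ = W := by rw [hWdef]
  -- steer the phases
  obtain ⟨θ, hθ⟩ := hphases σ hσ1 hση z hz
  -- the twist `u⋆`: shift by `τ₀` on `p ≤ y`, the steered phases beyond
  obtain ⟨us, hus⟩ := SWTwist.exists_twist fun p ↦ if p ≤ y then -(τ₀ * Real.log p) else θ p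
  have hus1 : ∀ p, p.Prime → ‖us p‖ = 1 := fun p hp ↦ by
    rw [hus p hp]; exact norm_exp_ofReal_mul_I _
  have hus_small : ∀ p, p.Prime → p ≤ y → us p = u₀ p := by
    intro p hp hpy
    rw [hus p hp, hu₀p p hp, if_pos hpy]
  have hus_big : ∀ p, p.Prime → y < p → us p = cexp (θ p * I) := by
    intro p hp hpy
    rw [hus p hp, if_neg (not_le.2 hpy)]
  have hus_n : ∀ m, m ≤ y → us m = u₀ m := by
    intro m hm
    have h := SWApprox.norm_twist_sub_twist_le hu₀1 hus1 (M := y) (δ := 0) le_rfl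
      (fun p hp hpy ↦ by rw [hus_small p hp hpy, sub_self, norm_zero]) hm
    rw [mul_zero] at h
    exact sub_eq_zero.1 (norm_le_zero_iff.1 h)
  have hLP : ∀ (i : ι) (s : ℂ), LSeries (fun m ↦ P i m * us m) s =
      LSeries (P i) (s + (τ₀ : ℂ) * I) := by
    intro i s
    rw [SWTwist.LSeries_add_eq_twist (P i) s τ₀ hu₀n]
    refine LSeries_congr (fun {m} _ ↦ ?_) s
    by_cases hPm : P i m = 0
    · simp [hPm]
    · rw [hus_n m ((hK i m hPm).trans hKy)]
  -- the function `G` and its value at `σ`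
  set G : ℂ → ℂ := fun s ↦ ∑ i, LSeries (fun m ↦ P i m * us m) s *
    LSeries (fun m ↦ χ i m * us m) s with hGdef
  have hGσ : G σ = 0 := by
    have hLχ : ∀ i, LSeries (fun m ↦ χ i m * us m) (σ : ℂ) = cexp (E i) * Z i := by
      intro i
      have hsum : HasSum (fun k : ℕ ↦ if k.Prime ∧ y < k then
          -log (1 - χ i k * us k * (k : ℂ) ^ (-(σ : ℂ))) else 0) (z i) := by
        have heq : (fun k : ℕ ↦ if k.Prime ∧ y < k then
            -log (1 - χ i k * us k * (k : ℂ) ^ (-(σ : ℂ))) else 0) =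
            fun k : ℕ ↦ if k.Prime ∧ y < k then
            -log (1 - ψ i k * cexp (θ k * I) * (k : ℂ) ^ (-(σ : ℂ))) else 0 := by
          funext k
          split_ifs with hk
          · rw [hχψ i k hk.1 (lt_of_le_of_lt hQy hk.2), hus_big k hk.1 hk.2]
          · rfl
        rw [heq]
        exact hθ i
      have h := LSeries_twist_eq_exp_mul (χ i) hus1 (s := (σ : ℂ)) (by simpa using hσ1) y hsum
      have hE : (∑ k ∈ Finset.range (y + 1), (if k.Prime then
          -log (1 - χ i k * us k * (k : ℂ) ^ (-(σ : ℂ))) else 0)) = E i := by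
        simp only [hEdef]
        refine Finset.sum_congr rfl fun k hk ↦ ?_
        split_ifs with hkp
        · rw [hus_small k hkp (Nat.lt_succ_iff.1 (Finset.mem_range.1 hk))]
        · rfl
      rw [h, hE, hzdef]
      simp only
      rw [Complex.exp_log (hZne i)]
    have : ∀ i, LSeries (fun m ↦ P i m * us m) σ * LSeries (fun m ↦ χ i m * us m) σ = T i := by
      intro i
      rw [hLP i σ, hLχ i]
      change LP i * (cexp (E i) * (T i / (LP i * cexp (E i)))) = T i
      field_simp [hLPne i, Complex.exp_ne_zero (E i)]
    simp only [hGdef, this, hTsum]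
  -- analyticity of `G`, a good circle
  obtain ⟨hGan, hGne⟩ := analyticOnNhd_and_eventually_ne_zero hF hus1
  have hcontG : ∀ w : ℂ, dist w σ < r₀ → ContinuousAt G w := by
    intro w hw
    refine (hGan w ?_).continuousAt
    show 1 < w.re
    have h1 : |w.re - σ| < r₀ := by
      have := abs_re_le_norm (w - σ)
      rw [sub_re, ofReal_re] at this
      rw [dist_eq_norm] at hw
      linarith
    have := (abs_lt.1 h1).1
    linarith
  obtain ⟨r, hr0, hrr₀, γ, hγ, hγle⟩ := exists_sphere_bound hr₀ hcontG (hGne σ (by simpa using hσ1))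
  have hσr1 : 1 < σ - r := by linarith
  -- uniform approximation and Kronecker
  obtain ⟨M, hKM, δ, hδ, happrox⟩ := SWApprox.exists_approx χ P hK hσr1 (γ := γ / 3) (by positivity)
  obtain ⟨L, hL, hdense⟩ := SWTools.exists_relDense_prime_phases M (fun p ↦ us p) hus1 hδ
  -- one zero in every window
  have hkey : ∀ s₀ : ℝ, ∃ ρ : ℂ, charCombination χ P ρ = 0 ∧ |ρ.re - σ| < r ∧ |ρ.im - s₀| ≤ L + r := by
    intro s₀
    obtain ⟨t, ht, hclose⟩ := hdense s₀
    obtain ⟨ut, -, hut1, hutn⟩ := SWTwist.exists_shift_twist t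
    have hclose' : ∀ p, p.Prime → p ≤ M → ‖ut p - us p‖ ≤ δ := by
      intro p hp hpM
      rw [hutn p hp.ne_zero]
      exact (hclose p hp hpM).le
    have happ : ∀ s ∈ closedBall (σ : ℂ) r,
        ‖∑ i, LSeries (fun m ↦ P i m * ut m) s * LSeries (fun m ↦ χ i m * ut m) s - G s‖ < γ / 3 := by
      intro s hs
      refine happrox us ut hus1 hut1 hclose' s ?_
      have h1 : |s.re - σ| ≤ r := by
        have := abs_re_le_norm (s - σ)
        rw [sub_re, ofReal_re] at this
        rw [mem_closedBall, dist_eq_norm] at hs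
        linarith
      have := (abs_le.1 h1).1
      linarith
    have hre1 : ∀ s ∈ closedBall (σ : ℂ) r, 1 < s.re := by
      intro s hs
      have h1 : |s.re - σ| ≤ r := by
        have := abs_re_le_norm (s - σ)
        rw [sub_re, ofReal_re] at this
        rw [mem_closedBall, dist_eq_norm] at hs
        linarith
      have := (abs_le.1 h1).1
      linarith
    -- `Ψ(s) = F(s + it)`
    set Ψ : ℂ → ℂ := fun s ↦ charCombination χ P (s + t * I) with hΨdef
    have hΨeq : ∀ s ∈ closedBall (σ : ℂ) r,
        Ψ s = ∑ i, LSeries (fun m ↦ P i m * ut m) s * LSeries (fun m ↦ χ i m * ut m) s :=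
      fun s hs ↦ charCombination_add_eq χ P (hre1 s hs) t hutn
    have hΨdiff : ∀ s ∈ closedBall (σ : ℂ) r, DifferentiableAt ℂ Ψ s := by
      intro s hs
      have hne1 : s + t * I ≠ 1 := by
        intro h
        have := congrArg re h
        simp at this
        linarith [hre1 s hs]
      have hg := differentiableAt_charCombination χ (P := P) hK hne1
      have hf : DifferentiableAt ℂ (fun s : ℂ ↦ s + t * I) s := differentiableAt_id.add_const _
      have hΨcomp : Ψ = (charCombination χ P) ∘ (fun s : ℂ ↦ s + t * I) := rfl
      rw [hΨcomp]
      exact hg.comp s hf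
    have hΨσ : ‖Ψ σ‖ < γ / 2 := by
      have hσmem : (σ : ℂ) ∈ closedBall (σ : ℂ) r := mem_closedBall_self hr0.le
      rw [hΨeq σ hσmem]
      have := happ σ hσmem
      rw [hGσ, sub_zero] at this
      linarith
    have hΨsphere : ∀ s ∈ sphere (σ : ℂ) r, γ / 2 ≤ ‖Ψ s‖ := by
      intro s hs
      have hs' : s ∈ closedBall (σ : ℂ) r := sphere_subset_closedBall hs
      rw [hΨeq s hs']
      have h1 := happ s hs'
      have h2 := hγle s hs
      have h3 := norm_sub_norm_le (G s)
        (∑ i, LSeries (fun m ↦ P i m * ut m) s * LSeries (fun m ↦ χ i m * ut m) s)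
      rw [norm_sub_rev] at h1
      linarith
    obtain ⟨z₁, hz₁, hΨz₁⟩ := SWTools.exists_zero_of_norm_lt hr0 hΨdiff hΨσ hΨsphere
    refine ⟨z₁ + t * I, hΨz₁, ?_, ?_⟩
    · have := abs_re_le_norm (z₁ - σ)
      rw [sub_re, ofReal_re] at this
      rw [mem_ball, dist_eq_norm] at hz₁
      simp only [add_re, mul_re, ofReal_re, I_re, mul_zero, ofReal_im, I_im, mul_one, sub_self,
        add_zero]
      linarith
    · have him : |z₁.im| < r := by
        have := abs_im_le_norm (z₁ - σ)
        rw [sub_im, ofReal_im, sub_zero] at this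
        rw [mem_ball, dist_eq_norm] at hz₁
        linarith
      have : (z₁ + t * I).im - s₀ = z₁.im + (t - s₀) := by
        simp only [add_im, mul_im, ofReal_re, I_im, ofReal_im, I_re, mul_one, mul_zero, add_zero]
        ring
      rw [this]
      have := abs_add_le z₁.im (t - s₀)
      linarith
  -- count
  obtain ⟨c₀, hc₀, T₀, hT₀⟩ := exists_many_zeros (by positivity : (0 : ℝ) ≤ L + r) hkey
  exact HasLinearlyManyZeros.of_abs_sub_lt (σ := σ) (r := r) (by linarith) (by linarith)
    ⟨c₀, hc₀, T₀, hT₀⟩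

end SWProof

/-- **Saias–Weingartner 2009, Theorem 2, strips to the right of `σ = 1`** — the named fact
`SaiasWeingartner2009_thm2_right` holds. [cite: SaiasWeingartner2009, Thm. 2 and §4] -/
theorem SaiasWeingartner2009_thm2_right_holds : SaiasWeingartner2009_thm2_right :=
  SWProof.thm2_right


end Literature.NumberTheory.LFunctions
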